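import Mathlib
import HarnessLib
import Literature.MathematicalPhysics.StatisticalMechanics.AbkmPackageShrink

/-!
# [ABKM19] — the large-set condition `hc3A` of a package DOMINATES the small-polymer conditions at any
# per-block integration constant up to `2^{d+1}·max(1, A_𝒫')` (room for the two-kernel comparison)

The `N`-free two-kernel comparison of the RG step `S_k` ([ABKM19] Lemma 12.6 (12.53); in the tree its linear
part `LinearisedMapKernelSubUnifTorusFRD.weakNormLE_opC_sub_unif_of_torusFRD`) measures the fluctuation-integral
DIFFERENCE `R_{q'}F − R_qF` with the Hölder pair property of Lemma 8.4, whose per-block constant is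
`κ' = 2^d·A_𝒫(ρ'')^{1/p}` — strictly LARGER than the package's integration constant `A_𝒫' = A_𝒫(θ)` for every
admissible Hölder pair (`ρ ↦ log A_𝒫(ρ)/(1+ρ)` is increasing) — and therefore asks the large-set parameter `A`
for the two conditions `κ' ≤ A` and `2^{L^d}·κ'·A^{−(1−η⁻¹)} ≤ 1` (`η = 1 + (2(2^d+1)+6)^{−d}`) AT `κ'`, whereas a
package (`AbkmPackageSlots.PackageData`) carries `hsmall` at `A_𝒫'` only.  No re-typing is needed for these two:
the package's pair condition `hc3A`
(`κ(r)^{L^d}·(2(2κ(r)max(1,A_𝒫')))^{cL^d}·4^{cL^d} ≤ A^{η−1}`, `c = (2^{d+1}+2)^d`, `κ(r) ≥ 2`) forces `A` to be so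
large that both conditions hold for EVERY `0 ≤ κ' ≤ 2^{d+1}·max(1, A_𝒫')`, with astronomically large room:

* `two_le_kappaABKM` — `κ(r) ≥ 2` (`A > 0`, `A_𝒫 ≥ 0`, `r ≥ 0`);
* `largeSet_margin_of_hc3A` — the real-arithmetic core (any `d ≥ 1`, `L ≥ 1`, `A ≥ 1`, `κ_r ≥ 2`);
* `PackageData.kappa'_le_A`, `PackageData.hsmall_margin` — the two conditions for a package at any
  `κ' ≤ 2^{d+1}·max(1, A_𝒫')`.

(The remaining freedom — choosing the Hölder pair `(p, ρ'')` with `A_𝒫(ρ'')^{1/p} ≤ 2A_𝒫'`, possible by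
continuity at `ρ'' = θ` — is not done here.)  Everything is proved; no named fact.  Use (honest scope): side
conditions for the child `TwoKernelSkBound` of the cruxes `HypACumulant` / `HypALocalTwoPoint` of the rung route
`Summits/HubbardSuperconductivity/…/Theses/ComplexGFFStiffness`; nothing about superconductivity in the Hubbard model.

## References
* S. Adams, S. Buchholz, R. Kotecký, S. Müller, *Cauchy–Born rule from microscopic models with non-convex
  potentials*, arXiv:1910.13564 — Theorem 6.8, Lemma 10.2, Lemma 12.6, Ch. 12 (12.4) [AdamsBuchholzKoteckyMuller2019].
-/

noncomputable section

namespace Literature.MathematicalPhysics.StatisticalMechanics.GradientRG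

variable {d : ℕ}

/-- `κ(r) = 1 + e^{1/4} + 16e^{3/8}(4r + 2v_r) ≥ 2` for `A > 0`, `A_𝒫 ≥ 0`, `r ≥ 0`.
[cite: AdamsBuchholzKoteckyMuller2019, Ch. 12 (12.4)] -/
theorem two_le_kappaABKM {R : ℕ} {A A𝒫 r : ℝ} (hA : 0 < A) (hA𝒫 : 0 ≤ A𝒫) (hr : 0 ≤ r) :
    2 ≤ kappaABKM d R A A𝒫 r := by
  unfold kappaABKM vABKM
  have hC : 0 ≤ pi2BoundConst d (((2 * R + 2 : ℕ) : ℝ) + ((d / 2 + 1 : ℕ) : ℝ)) :=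
    pi2BoundConst_nonneg d (by positivity)
  have hAinv : 0 ≤ A⁻¹ := inv_nonneg.2 hA.le
  have he : 1 ≤ Real.exp (1 / 4) := Real.one_le_exp (by norm_num)
  have h3 : 0 ≤ 16 * Real.exp (3 / 8) * (4 * r + 2 * (pi2BoundConst d (((2 * R + 2 : ℕ) : ℝ) + ((d / 2 + 1 : ℕ) : ℝ)) *
      (r * A𝒫 * A⁻¹))) := by positivity
  linarith

/-- **The large-set pair condition dominates the small-polymer conditions with room** (real-arithmetic core):
for `d, L ≥ 1`, `A ≥ 1`, `κ_r ≥ 2` and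
`κ_r^{L^d}·((2(2κ_r·max(1,A_𝒫')))^{cL^d}·4^{cL^d}) ≤ A^{(1+1/c'')−1}` (`c = (2^{d+1}+2)^d`, `c'' = (2(2^d+1)+6)^d`),
every `0 ≤ κ' ≤ 2^{d+1}·max(1, A_𝒫')` satisfies `κ' ≤ A` and `2^{L^d}·κ'·A^{−(1−(1+1/c'')⁻¹)} ≤ 1`.
[cite: AdamsBuchholzKoteckyMuller2019, Ch. 12 (12.4) / Lemma 10.2] -/
theorem largeSet_margin_of_hc3A {L : ℕ} (hd : 1 ≤ d) (hL : 1 ≤ L) {A A𝒫' κr κ' : ℝ} (hA1 : 1 ≤ A)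
    (hκr : 2 ≤ κr) (hκ'0 : 0 ≤ κ') (hκ' : κ' ≤ (2 : ℝ) ^ (d + 1) * max 1 A𝒫')
    (hc3A : κr ^ (L ^ d) * ((2 * (2 * κr * max 1 A𝒫')) ^ ((2 ^ (d + 1) + 2) ^ d * L ^ d) *
      (4 : ℝ) ^ ((2 ^ (d + 1) + 2) ^ d * L ^ d)) ≤ A ^ ((1 + 1 / ((2 * (2 ^ d + 1) + 6 : ℝ) ^ d)) - 1 : ℝ)) :
    κ' ≤ A ∧ (2 : ℝ) ^ (L ^ d) * (κ' * A ^ (-(1 - (1 + 1 / ((2 * (2 ^ d + 1) + 6 : ℝ) ^ d))⁻¹) : ℝ)) ≤ 1 := by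
  -- names
  set m : ℝ := max 1 A𝒫' with hm
  set c : ℕ := (2 ^ (d + 1) + 2) ^ d with hc
  set n : ℕ := c * L ^ d with hn
  set c'' : ℝ := (2 * (2 ^ d + 1) + 6 : ℝ) ^ d with hc''
  set e : ℝ := 1 / c'' with he
  have hm1 : 1 ≤ m := le_max_left _ _
  have hm0 : 0 ≤ m := zero_le_one.trans hm1
  have hA0 : 0 ≤ A := zero_le_one.trans hA1
  have hc''1 : 1 ≤ c'' := by
    rw [hc'']
    have h2d : (0 : ℝ) ≤ 2 ^ d := by positivity
    exact one_le_pow₀ (by linarith)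
  have hc''0 : 0 < c'' := lt_of_lt_of_le one_pos hc''1
  have he0 : 0 < e := by rw [he]; positivity
  have he1 : e ≤ 1 := by rw [he, div_le_one hc''0]; exact hc''1
  have hexp1 : (1 + 1 / c'') - 1 = e := by rw [he]; ring
  have hexp2 : -(1 - (1 + 1 / c'')⁻¹) = -(e * (1 / (1 + e))) := by
    rw [he]; field_simp; ring
  rw [hexp1] at hc3A
  rw [hexp2]
  -- integer bookkeeping: `d + 1 ≤ c`, `2 ≤ n`, `2(L^d + d + 1) ≤ 5n`
  have hLd : 1 ≤ L ^ d := Nat.one_le_pow _ _ hL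
  have hdc : d + 1 ≤ c := by
    rw [hc]
    have h4 : 1 < 2 ^ (d + 1) + 2 := by have := Nat.one_le_two_pow (n := d + 1); omega
    exact Nat.lt_pow_self h4
  have hc2 : 2 ≤ c := le_trans (by omega) hdc
  have hn2 : 2 ≤ n := by rw [hn]; nlinarith
  have h5n : 2 * (L ^ d + d + 1) ≤ 5 * n := by rw [hn]; nlinarith
  -- `X ≥ (32 m)^n ≥ Y²`, `Y = 2^{L^d} 2^{d+1} m`
  set Y : ℝ := (2 : ℝ) ^ (L ^ d) * ((2 : ℝ) ^ (d + 1) * m) with hY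
  have hY1 : 1 ≤ Y := by
    rw [hY]
    have h1 : (1 : ℝ) ≤ 2 ^ (L ^ d) := one_le_pow₀ (by norm_num)
    have h2 : (1 : ℝ) ≤ 2 ^ (d + 1) := one_le_pow₀ (by norm_num)
    nlinarith
  have hY0 : 0 ≤ Y := zero_le_one.trans hY1
  have hX1 : (1 : ℝ) ≤ κr ^ (L ^ d) := one_le_pow₀ (by linarith)
  have h8m : (8 * m) ^ n ≤ (2 * (2 * κr * m)) ^ n := by
    apply pow_le_pow_left₀ (by positivity)
    nlinarith
  have h32 : (32 * m) ^ n = (8 * m) ^ n * (4 : ℝ) ^ n := by rw [← mul_pow]; ring_nf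
  have hX : (32 * m) ^ n ≤ κr ^ (L ^ d) * ((2 * (2 * κr * m)) ^ n * (4 : ℝ) ^ n) := by
    rw [h32]
    have h1 : (8 * m) ^ n * (4 : ℝ) ^ n ≤ (2 * (2 * κr * m)) ^ n * (4 : ℝ) ^ n :=
      mul_le_mul_of_nonneg_right h8m (by positivity)
    calc (8 * m) ^ n * (4 : ℝ) ^ n = 1 * ((8 * m) ^ n * (4 : ℝ) ^ n) := (one_mul _).symm
      _ ≤ κr ^ (L ^ d) * ((2 * (2 * κr * m)) ^ n * (4 : ℝ) ^ n) :=
          mul_le_mul hX1 h1 (by positivity) (by positivity)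
  have hXA : (32 * m) ^ n ≤ A ^ e := hX.trans hc3A
  have hY2 : Y ^ 2 ≤ (32 * m) ^ n := by
    have e1 : Y ^ 2 = (2 : ℝ) ^ (2 * (L ^ d + d + 1)) * m ^ 2 := by rw [hY]; ring
    have h32' : (2 : ℝ) ^ (5 * n) = 32 ^ n := by rw [pow_mul]; norm_num
    have e2 : ((32 : ℝ) * m) ^ n = (2 : ℝ) ^ (5 * n) * m ^ n := by rw [mul_pow, h32']
    rw [e1, e2]
    have h1 : (2 : ℝ) ^ (2 * (L ^ d + d + 1)) ≤ (2 : ℝ) ^ (5 * n) := pow_le_pow_right₀ (by norm_num) h5n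
    have h2 : m ^ 2 ≤ m ^ n := pow_le_pow_right₀ hm1 hn2
    exact mul_le_mul h1 h2 (by positivity) (by positivity)
  have hYA : Y ^ 2 ≤ A ^ e := hY2.trans hXA
  -- (i) `κ' ≤ A`
  have hκY : κ' ≤ Y := by
    rw [hY]
    have h1 : (1 : ℝ) ≤ 2 ^ (L ^ d) := one_le_pow₀ (by norm_num)
    have h0 : 0 ≤ (2 : ℝ) ^ (d + 1) * m := by positivity
    nlinarith
  have hYY2 : Y ≤ Y ^ 2 := by nlinarith
  have hAeA : A ^ e ≤ A := by
    have := Real.rpow_le_rpow_of_exponent_le hA1 he1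
    rwa [Real.rpow_one] at this
  refine ⟨hκY.trans (hYY2.trans (hYA.trans hAeA)), ?_⟩
  -- (ii) `2^{L^d} κ' ≤ A^{e/(1+e)}`
  have h1e : 0 < 1 + e := by linarith
  have hhalf : (1 : ℝ) / 2 ≤ 1 / (1 + e) := by
    rw [div_le_div_iff₀ (by norm_num) h1e]; linarith
  have hpow : Y ≤ A ^ (e * (1 / (1 + e))) := by
    rw [Real.rpow_mul hA0]
    have hY2nn : 0 ≤ Y ^ 2 := by positivity
    have h1 : (Y ^ 2) ^ (1 / (1 + e) : ℝ) ≤ (A ^ e) ^ (1 / (1 + e) : ℝ) :=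
      Real.rpow_le_rpow hY2nn hYA (by positivity)
    have hY21 : (1 : ℝ) ≤ Y ^ 2 := one_le_pow₀ hY1
    have h2 : (Y ^ 2) ^ (1 / 2 : ℝ) ≤ (Y ^ 2) ^ (1 / (1 + e) : ℝ) :=
      Real.rpow_le_rpow_of_exponent_le hY21 hhalf
    have h3 : (Y ^ 2) ^ (1 / 2 : ℝ) = Y := by
      rw [← Real.sqrt_eq_rpow, Real.sqrt_sq hY0]
    linarith [h1, h2, h3.symm.le, h3.le]
  have hApos : 0 < A ^ (e * (1 / (1 + e))) := Real.rpow_pos_of_pos (lt_of_lt_of_le one_pos hA1) _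
  rw [Real.rpow_neg hA0]
  have hgoal : (2 : ℝ) ^ (L ^ d) * κ' ≤ A ^ (e * (1 / (1 + e))) := by
    have h0 : 0 ≤ (2 : ℝ) ^ (L ^ d) := by positivity
    calc (2 : ℝ) ^ (L ^ d) * κ' ≤ (2 : ℝ) ^ (L ^ d) * ((2 : ℝ) ^ (d + 1) * m) := mul_le_mul_of_nonneg_left hκ' h0
      _ = Y := by rw [hY]
      _ ≤ A ^ (e * (1 / (1 + e))) := hpow
  calc (2 : ℝ) ^ (L ^ d) * (κ' * (A ^ (e * (1 / (1 + e))))⁻¹)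
      = ((2 : ℝ) ^ (L ^ d) * κ') / A ^ (e * (1 / (1 + e))) := by rw [div_eq_mul_inv]; ring
    _ ≤ 1 := by rw [div_le_one hApos]; exact hgoal

namespace PackageData

/-- For a package, `κ(r) ≥ 2`. [cite: AdamsBuchholzKoteckyMuller2019, Ch. 12 (12.4)] -/
theorem two_le_kappa (P : PackageData d) : 2 ≤ kappaABKM d P.R P.A P.A𝒫' P.r :=
  two_le_kappaABKM P.A_pos P.A𝒫'_nonneg P.hr0

/-- **`κ' ≤ A`** for every `κ' ≤ 2^{d+1}·max(1, A_𝒫')` (from the package's `hc3A`).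
[cite: AdamsBuchholzKoteckyMuller2019, Ch. 12 (12.4)] -/
theorem kappa'_le_A (P : PackageData d) {κ' : ℝ} (h0 : 0 ≤ κ') (hκ' : κ' ≤ (2 : ℝ) ^ (d + 1) * max 1 P.A𝒫') :
    κ' ≤ P.A :=
  (largeSet_margin_of_hc3A (L := P.L) (le_trans (by norm_num) P.hd) P.hLodd.pos P.hA1 P.two_le_kappa h0 hκ'
    P.hc3A).1

/-- **The small-polymer condition with room**: `2^{L^d}·κ'·A^{−(1−η⁻¹)} ≤ 1` for every
`κ' ≤ 2^{d+1}·max(1, A_𝒫')`, `η = 1 + (2(2^d+1)+6)^{−d}` (from the package's `hc3A`; at `κ' = A_𝒫'` this is the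
field `hsmall`). [cite: AdamsBuchholzKoteckyMuller2019, Lemma 10.2 / Ch. 12 (12.4)] -/
theorem hsmall_margin (P : PackageData d) {κ' : ℝ} (h0 : 0 ≤ κ') (hκ' : κ' ≤ (2 : ℝ) ^ (d + 1) * max 1 P.A𝒫') :
    (2 : ℝ) ^ (P.L ^ d) * (κ' * P.A ^ (-(1 - (1 + 1 / ((2 * (2 ^ d + 1) + 6 : ℝ) ^ d))⁻¹) : ℝ)) ≤ 1 :=
  (largeSet_margin_of_hc3A (L := P.L) (le_trans (by norm_num) P.hd) P.hLodd.pos P.hA1 P.two_le_kappa h0 hκ'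
    P.hc3A).2

end PackageData

end Literature.MathematicalPhysics.StatisticalMechanics.GradientRG

end
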